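import Mathlib
import Literature.AlgebraicGeometry.Resolution.AugmentationIdeal
import Summits.ResolutionOfSingularities.ResolutionOfSingularities.Theorems.WildQuotientsWildQuotientResolutionFixedPointsRegular
import Summits.ResolutionOfSingularities.ResolutionOfSingularities.Theorems.WildQuotientsWildQuotientResolutionJordanFiveMu2CoverLaws
import Summits.ResolutionOfSingularities.ResolutionOfSingularities.Theorems.WildQuotientsWildQuotientResolutionJordanFiveMu2CoverDefs
import Summits.ResolutionOfSingularities.ResolutionOfSingularities.Theorems.WildQuotientsWildQuotientResolutionJordanFiveMu2CoverAction
import Summits.ResolutionOfSingularities.ResolutionOfSingularities.Theorems.WildQuotientsWildQuotientResolutionJordanFiveMu2CoverActionExists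
import Summits.ResolutionOfSingularities.ResolutionOfSingularities.Theorems.WildQuotientsWildQuotientResolutionJordanFiveMu2CoverDescent

/-!
# RUNG V5 (`J₅`), brick B7/HP₂ — part (β): Kiraly–Lütkebohmert at `p` on the twisted-root cover

Sub-problem `ResolutionOfSingularities`, crux `WildQuotients.WildQuotientResolution`
(stmt-ResolutionOfSingularities-15640), line L1 W4.5c, scaffold
`JordanFive.jordanFive_hasResolution_of_bricks` (p527978), brick `HP₂` (res-L1-w45c-plan-1 RULING
10:50Z; card `mu2-strata-kl-twice` of res-L1-w45c-idea-2).

The `μ₂`-vertex chart `W₂` of the first blow-up of `𝔸⁵/J₅` carries NO translation slice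
(RT-J5 §5); instead one passes to the twisted-root cover
`U₂ = (k[s, Y₀,…,Y₄, pass] ⧸ (Φ))[1/î]` (…`Mu2CoverDefs`), on which `J₅` acts by the cover laws
`s ↦ s, Y₀ ↦ Y₀, Y_j ↦ Y_j + sY_{j-1}` with augmentation ideal `(s)` (…`Mu2CoverLaws`).  This file is
the Kiraly–Lütkebohmert step at `p` [KL13, Thm. 2 ⇐]: **the ring of invariants `U₂^{σ}` is
regular**.  It is stated LAW-BASED and for an arbitrary localisation `U` of `k[x] ⧸ I` away from
`ι` (`IsLocalization.Away`), so that it applies verbatim to the section rings of the geometric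
side (res-L1-w45c-stub-5's seam) as well as to `Localization.Away` itself:

* `isRegularRing_fixedPoints_of_coverLaws` — abstract exit: cover laws + a unit in
  `(Y₀, Y₁, Y₂, Y₃)` + generation ⇒ `U^σ` regular (K–L via
  `TameTransfer.isRegularRing_fixedPoints_zpowers`, p460154);
* `cover_laws_comp` — U-side laws + A-side laws ⇒ `σ_U ∘ π = π ∘ σ_A` on the variables (so the
  Mathlib-only descent file …`Mu2CoverDescent` applies: `σ_U` is determined, `σ_U ^ p = 1`);
* `coverIHat_notMem_span_coverPhi` — `î ∉ (Φ)` (so `U₂ ≠ 0` and `B ↪ U₂`);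
* **`isRegularRing_fixedPoints_cover`** — for every `k`-automorphism `σ_U` of `U` with the
  cover laws (`p ≥ 5`, `U` a regular domain): `U^{⟨σ_U⟩}` is a regular ring.
-/

-- single-problem summit: the doubled namespace component `ResolutionOfSingularities` is forced
set_option linter.dupNamespace false

noncomputable section

open MvPolynomial Literature.AlgebraicGeometry.Resolution

namespace Summit.ResolutionOfSingularities.ResolutionOfSingularities.Theorems.WildQuotientResolution.JordanFive

/-! ## Abstract K–L exit from the cover laws -/

/-- **K–L at `p` from the cover laws.**  If a `k`-automorphism `σ` of order `p` of a regular
domain `U` of finite type satisfies the cover laws on `s, Y₀, …, Y₄`, some element of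
`(Y₀, Y₁, Y₂, Y₃)` is a unit, and `U` is generated by the six coordinates and `σ`-fixed elements,
then `I_σ = (s)` is principal and `U^{⟨σ⟩}` is regular [cite: KiralyLutkebohmert2013, Thm. 2 ⇐].
[OURS · L1 W4.5c] -/
theorem isRegularRing_fixedPoints_of_coverLaws {k U : Type} [Field k] [CommRing U] [IsDomain U]
    [IsRegularRing U] [Algebra k U] [Algebra.FiniteType k U] {p : ℕ} (hp : p.Prime)
    (σ : U ≃ₐ[k] U) (hσ1 : σ ≠ 1) (hσp : σ ^ p = 1) (s Y₀ Y₁ Y₂ Y₃ Y₄ : U)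
    (hs : σ s = s) (h0 : σ Y₀ = Y₀) (h1 : σ Y₁ = Y₁ + s * Y₀) (h2 : σ Y₂ = Y₂ + s * Y₁)
    (h3 : σ Y₃ = Y₃ + s * Y₂) (h4 : σ Y₄ = Y₄ + s * Y₃)
    {z : U} (hz : z ∈ Ideal.span ({Y₀, Y₁, Y₂, Y₃} : Set U)) (hunit : IsUnit z)
    (G : Set U) (hGfix : ∀ g ∈ G, σ g = g)
    (hgen : Algebra.adjoin k (({s, Y₀, Y₁, Y₂, Y₃, Y₄} : Set U) ∪ G) = ⊤) :
    IsRegularRing (FixedPoints.subalgebra k U (Subgroup.zpowers σ)) := by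
  have haug : Ideal.span (Set.range fun u : U => σ u - u) = Ideal.span {s} := by
    have h := mu2Cover_augIdeal_eq_span_s s Y₀ Y₁ Y₂ Y₃ Y₄ (σ : U →ₐ[k] U) hs h0 h1 h2 h3 h4 hz
      hunit G hGfix hgen
    rw [augIdeal_def] at h
    exact h
  refine TameTransfer.isRegularRing_fixedPoints_zpowers hp σ hσ1 hσp (fun 𝔮 _ _ => ?_)
  rw [haug, Ideal.map_span, Set.image_singleton]
  exact ⟨⟨algebraMap U (Localization.AtPrime 𝔮) s, rfl⟩⟩

/-! ## The cover: `î ∉ (Φ)` and the K–L exit -/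

section Cover

variable (k : Type) [Field k] (n : ℕ) (a b c d e : Fin n)
  (hab : a ≠ b) (hac : a ≠ c) (had : a ≠ d) (hae : a ≠ e) (hbc : b ≠ c) (hbd : b ≠ d)
  (hbe : b ≠ e) (hcd : c ≠ d) (hce : c ≠ e) (hde : d ≠ e)

include hac hbc hcd hce in
/-- **`î ∉ (Φ)`**: at the core point `s = Y₀ = Y₁ = Y₃ = 0`, `Y₂ = 1` (all passengers `0`) one has
`Φ = 0` and `î = 1`. [OURS · L1 W4.5c] -/
theorem coverIHat_notMem_span_coverPhi :
    coverIHat (X none) (X (some a)) (X (some b)) (X (some c)) (X (some d)) (X (some e)) ∉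
      Ideal.span {coverPhi (X none) (X (some a)) (X (some b)) (X (some c)) (X (some d))
        (X (some e) : MvPolynomial (Option (Fin n)) k)} := by
  classical
  intro h
  obtain ⟨q, hq⟩ := Ideal.mem_span_singleton'.mp h
  let f : Option (Fin n) → k := fun o => if o = some c then 1 else 0
  have hs : eval f (X none : MvPolynomial (Option (Fin n)) k) = 0 := by
    rw [eval_X]; exact if_neg (Option.some_ne_none c).symm
  have hX : ∀ i, i ≠ c → eval f (X (some i) : MvPolynomial (Option (Fin n)) k) = 0 := by
    intro i hi; rw [eval_X]; exact if_neg (fun h => hi (Option.some_inj.mp h))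
  have hc : eval f (X (some c) : MvPolynomial (Option (Fin n)) k) = 1 := by
    rw [eval_X]; exact if_pos rfl
  have hΦ : eval f (coverPhi (X none) (X (some a)) (X (some b)) (X (some c)) (X (some d))
      (X (some e) : MvPolynomial (Option (Fin n)) k)) = 0 := by
    rw [map_coverPhi, hs, hX a hac, hX b hbc, hc, hX d hcd.symm, hX e hce.symm, coverPhi_core]
    ring
  have hI : eval f (coverIHat (X none) (X (some a)) (X (some b)) (X (some c)) (X (some d))
      (X (some e) : MvPolynomial (Option (Fin n)) k)) = 1 := by
    rw [map_coverIHat, hs, hX a hac, hX b hbc, hc, hX d hcd.symm, hX e hce.symm, coverIHat_core]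
    ring
  have := congrArg (eval f) hq
  rw [map_mul, hΦ, mul_zero, hI] at this
  exact zero_ne_one this

variable (I : Ideal (MvPolynomial (Option (Fin n)) k)) (ι : MvPolynomial (Option (Fin n)) k)
  (U : Type) [CommRing U] [Algebra (MvPolynomial (Option (Fin n)) k ⧸ I) U]
  [IsLocalization.Away (Ideal.Quotient.mk I ι) U] [Algebra k U]
  [IsScalarTower k (MvPolynomial (Option (Fin n)) k ⧸ I) U]

omit [IsLocalization.Away (Ideal.Quotient.mk I ι) U] [IsScalarTower k (MvPolynomial (Option (Fin n)) k ⧸ I) U] in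
/-- The cover laws for `σ_U` on `U` and for `σ_A` on `k[s, Y, pass]` make `σ_U ∘ π = π ∘ σ_A` on the
variables. [OURS · L1 W4.5c] -/
theorem cover_laws_comp (σU : U ≃ₐ[k] U)
    (σA : MvPolynomial (Option (Fin n)) k ≃ₐ[k] MvPolynomial (Option (Fin n)) k)
    (hs : σU (algebraMap _ U (Ideal.Quotient.mk I (X none))) =
      algebraMap _ U (Ideal.Quotient.mk I (X none)))
    (h1 : σU (algebraMap _ U (Ideal.Quotient.mk I (X (some b)))) =
      algebraMap _ U (Ideal.Quotient.mk I (X (some b))) +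
        algebraMap _ U (Ideal.Quotient.mk I (X none)) *
          algebraMap _ U (Ideal.Quotient.mk I (X (some a))))
    (h2 : σU (algebraMap _ U (Ideal.Quotient.mk I (X (some c)))) =
      algebraMap _ U (Ideal.Quotient.mk I (X (some c))) +
        algebraMap _ U (Ideal.Quotient.mk I (X none)) *
          algebraMap _ U (Ideal.Quotient.mk I (X (some b))))
    (h3 : σU (algebraMap _ U (Ideal.Quotient.mk I (X (some d)))) =
      algebraMap _ U (Ideal.Quotient.mk I (X (some d))) +
        algebraMap _ U (Ideal.Quotient.mk I (X none)) *
          algebraMap _ U (Ideal.Quotient.mk I (X (some c))))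
    (h4 : σU (algebraMap _ U (Ideal.Quotient.mk I (X (some e)))) =
      algebraMap _ U (Ideal.Quotient.mk I (X (some e))) +
        algebraMap _ U (Ideal.Quotient.mk I (X none)) *
          algebraMap _ U (Ideal.Quotient.mk I (X (some d))))
    (hσ : ∀ i, i ≠ b → i ≠ c → i ≠ d → i ≠ e →
      σU (algebraMap _ U (Ideal.Quotient.mk I (X (some i)))) =
        algebraMap _ U (Ideal.Quotient.mk I (X (some i))))
    (hAs : σA (X none) = X none)
    (hA1 : σA (X (some b)) = X (some b) + X none * X (some a))
    (hA2 : σA (X (some c)) = X (some c) + X none * X (some b))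
    (hA3 : σA (X (some d)) = X (some d) + X none * X (some c))
    (hA4 : σA (X (some e)) = X (some e) + X none * X (some d))
    (hAσ : ∀ i, i ≠ b → i ≠ c → i ≠ d → i ≠ e → σA (X (some i)) = X (some i)) :
    ∀ o, σU (algebraMap _ U (Ideal.Quotient.mk I (X o))) =
      algebraMap _ U (Ideal.Quotient.mk I (σA (X o))) := by
  rintro (_ | i)
  · rw [hs, hAs]
  · by_cases hib : i = b
    · subst hib; rw [h1, hA1, map_add, map_mul, map_add, map_mul]
    by_cases hic : i = c
    · subst hic; rw [h2, hA2, map_add, map_mul, map_add, map_mul]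
    by_cases hid : i = d
    · subst hid; rw [h3, hA3, map_add, map_mul, map_add, map_mul]
    by_cases hie : i = e
    · subst hie; rw [h4, hA4, map_add, map_mul, map_add, map_mul]
    rw [hσ i hib hic hid hie, hAσ i hib hic hid hie]

include hab hac had hae hbc hbd hbe hcd hce hde in
/-- **K–L at `p` on the twisted-root cover (law-based).**  Let `U` be a localisation of
`k[s, Y, pass] ⧸ I` away from `ι`, a regular domain, with `ι ∈ (Y₀, Y₁, Y₂, Y₃)`, and let `σ_U` be a
`k`-automorphism of `U` with the cover laws `s ↦ s`, `Y₁ ↦ Y₁ + sY₀, …, Y₄ ↦ Y₄ + sY₃`, passengers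
and `ι` fixed, `s·Y₀ ≠ 0` in `U`.  Then (`p ≥ 5`) `σ_U` has order `p`, `I_{σ_U} = (s)`, and **the ring
of invariants `U^{⟨σ_U⟩}` is regular** [cite: KiralyLutkebohmert2013, Thm. 2 ⇐].  On `U₂` this is
step (β) of brick HP₂. [OURS · L1 W4.5c] -/
theorem isRegularRing_fixedPoints_cover {p : ℕ} [CharP k p] (hp : p.Prime) (hp5 : 5 ≤ p)
    [IsDomain U] [IsRegularRing U] (σU : U ≃ₐ[k] U)
    (hs : σU (algebraMap _ U (Ideal.Quotient.mk I (X none))) =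
      algebraMap _ U (Ideal.Quotient.mk I (X none)))
    (h1 : σU (algebraMap _ U (Ideal.Quotient.mk I (X (some b)))) =
      algebraMap _ U (Ideal.Quotient.mk I (X (some b))) +
        algebraMap _ U (Ideal.Quotient.mk I (X none)) *
          algebraMap _ U (Ideal.Quotient.mk I (X (some a))))
    (h2 : σU (algebraMap _ U (Ideal.Quotient.mk I (X (some c)))) =
      algebraMap _ U (Ideal.Quotient.mk I (X (some c))) +
        algebraMap _ U (Ideal.Quotient.mk I (X none)) *
          algebraMap _ U (Ideal.Quotient.mk I (X (some b))))
    (h3 : σU (algebraMap _ U (Ideal.Quotient.mk I (X (some d)))) =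
      algebraMap _ U (Ideal.Quotient.mk I (X (some d))) +
        algebraMap _ U (Ideal.Quotient.mk I (X none)) *
          algebraMap _ U (Ideal.Quotient.mk I (X (some c))))
    (h4 : σU (algebraMap _ U (Ideal.Quotient.mk I (X (some e)))) =
      algebraMap _ U (Ideal.Quotient.mk I (X (some e))) +
        algebraMap _ U (Ideal.Quotient.mk I (X none)) *
          algebraMap _ U (Ideal.Quotient.mk I (X (some d))))
    (hσ : ∀ i, i ≠ b → i ≠ c → i ≠ d → i ≠ e →
      σU (algebraMap _ U (Ideal.Quotient.mk I (X (some i)))) =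
        algebraMap _ U (Ideal.Quotient.mk I (X (some i))))
    (hιU : σU (algebraMap _ U (Ideal.Quotient.mk I ι)) = algebraMap _ U (Ideal.Quotient.mk I ι))
    (hιspan : ι ∈ Ideal.span ({X (some a), X (some b), X (some c), X (some d)} :
      Set (MvPolynomial (Option (Fin n)) k)))
    (hne : algebraMap _ U (Ideal.Quotient.mk I (X none)) *
      algebraMap _ U (Ideal.Quotient.mk I (X (some a))) ≠ 0) :
    IsRegularRing (FixedPoints.subalgebra k U (Subgroup.zpowers σU)) := by
  classical
  haveI : Algebra.FiniteType k U := away_quotient_finiteType k n I ι U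
  obtain ⟨σA, hAs, hA1, hA2, hA3, hA4, hAσ⟩ :=
    exists_coverSigma k n a b c d e hab hac had hae hbc hbd hbe hcd hce hde
  have h0 : σU (algebraMap _ U (Ideal.Quotient.mk I (X (some a)))) =
      algebraMap _ U (Ideal.Quotient.mk I (X (some a))) := hσ a hab hac had hae
  -- `σ_U ∘ π = π ∘ σ_A` on the variables
  have hcomp := cover_laws_comp k n a b c d e I U σU σA hs h1 h2 h3 h4 hσ hAs hA1 hA2 hA3 hA4 hAσ
  have hσp : σU ^ p = 1 :=
    cover_pow_eq_one_of k n I ι U σU σA hcomp p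
      (cover_pow_prime_eq_one k n σA a b c d e hab hac had hae hAs hA1 hA2 hA3 hA4 hAσ p hp hp5)
  have hσ1 : σU ≠ 1 := by
    intro h
    apply hne
    have h1' := h1
    rw [h, AlgEquiv.one_apply] at h1'
    exact add_eq_left.mp h1'.symm
  -- the unit `π ι ∈ (Y₀, Y₁, Y₂, Y₃)`
  have hz : algebraMap _ U (Ideal.Quotient.mk I ι) ∈
      Ideal.span ({algebraMap _ U (Ideal.Quotient.mk I (X (some a))),
        algebraMap _ U (Ideal.Quotient.mk I (X (some b))),
        algebraMap _ U (Ideal.Quotient.mk I (X (some c))),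
        algebraMap _ U (Ideal.Quotient.mk I (X (some d)))} : Set U) := by
    have := Ideal.mem_map_of_mem (algebraMap (MvPolynomial (Option (Fin n)) k ⧸ I) U)
      (Ideal.mem_map_of_mem (Ideal.Quotient.mk I) hιspan)
    simpa only [Ideal.map_span, Set.image_insert_eq, Set.image_singleton] using this
  -- the fixed generators: passengers, `s`, `Y₀`, and `1/ι`
  have hinvfix : σU (IsLocalization.Away.invSelf (Ideal.Quotient.mk I ι)) =
      IsLocalization.Away.invSelf (Ideal.Quotient.mk I ι) := by
    have e1 : algebraMap _ U (Ideal.Quotient.mk I ι) *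
        IsLocalization.Away.invSelf (Ideal.Quotient.mk I ι) = 1 :=
      IsLocalization.Away.mul_invSelf _
    have e2 : algebraMap _ U (Ideal.Quotient.mk I ι) *
        σU (IsLocalization.Away.invSelf (Ideal.Quotient.mk I ι)) = 1 := by
      rw [← hιU, ← map_mul, e1, map_one]
    calc σU (IsLocalization.Away.invSelf (Ideal.Quotient.mk I ι))
        = σU (IsLocalization.Away.invSelf (Ideal.Quotient.mk I ι)) *
            (algebraMap _ U (Ideal.Quotient.mk I ι) *
              IsLocalization.Away.invSelf (Ideal.Quotient.mk I ι)) := by rw [e1, mul_one]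
      _ = algebraMap _ U (Ideal.Quotient.mk I ι) *
            σU (IsLocalization.Away.invSelf (Ideal.Quotient.mk I ι)) *
              IsLocalization.Away.invSelf (Ideal.Quotient.mk I ι) := by ring
      _ = IsLocalization.Away.invSelf (Ideal.Quotient.mk I ι) := by rw [e2, one_mul]
  let G : Set U := {u | u ∈ Set.range (fun o => algebraMap _ U (Ideal.Quotient.mk I (X o))) ∧
      σU u = u} ∪ {IsLocalization.Away.invSelf (Ideal.Quotient.mk I ι)}
  have hGfix : ∀ g ∈ G, σU g = g := by
    rintro g (⟨-, hg⟩ | hg)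
    · exact hg
    · rw [Set.mem_singleton_iff] at hg
      rw [hg, hinvfix]
  have hgen : Algebra.adjoin k (({algebraMap _ U (Ideal.Quotient.mk I (X none)),
      algebraMap _ U (Ideal.Quotient.mk I (X (some a))),
      algebraMap _ U (Ideal.Quotient.mk I (X (some b))),
      algebraMap _ U (Ideal.Quotient.mk I (X (some c))),
      algebraMap _ U (Ideal.Quotient.mk I (X (some d))),
      algebraMap _ U (Ideal.Quotient.mk I (X (some e)))} : Set U) ∪ G) = ⊤ := by
    rw [eq_top_iff, ← away_quotient_adjoin_eq_top k n I ι U]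
    refine Algebra.adjoin_mono ?_
    rintro u (⟨o, rfl⟩ | hu)
    · rcases o with _ | i
      · exact Or.inl (by simp only [Set.mem_insert_iff, Set.mem_singleton_iff, true_or])
      · by_cases hib : i = b
        · subst hib; exact Or.inl (by simp only [Set.mem_insert_iff, true_or, or_true])
        by_cases hic : i = c
        · subst hic; exact Or.inl (by simp only [Set.mem_insert_iff, true_or, or_true])
        by_cases hid : i = d
        · subst hid; exact Or.inl (by simp only [Set.mem_insert_iff, true_or, or_true])
        by_cases hie : i = e
        · subst hie
          exact Or.inl (by simp only [Set.mem_insert_iff, Set.mem_singleton_iff, or_true])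
        exact Or.inr (Or.inl ⟨⟨some i, rfl⟩, hσ i hib hic hid hie⟩)
    · exact Or.inr (Or.inr hu)
  exact isRegularRing_fixedPoints_of_coverLaws hp σU hσ1 hσp _ _ _ _ _ _ hs h0 h1 h2 h3 h4 hz
    (IsLocalization.Away.algebraMap_isUnit (Ideal.Quotient.mk I ι)) G hGfix hgen

end Cover

end Summit.ResolutionOfSingularities.ResolutionOfSingularities.Theorems.WildQuotientResolution.JordanFive

end
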